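import Summits.BirchSwinnertonDyer.BirchSwinnertonDyer.Theorems.Rank2Observatory2DescClCertBasic
import HarnessLib

/-!
# BirchSwinnertonDyer — rank ≥ 2 observatory: KERNEL-2DESC-CL — the EXACT SPLIT LOCAL IMAGE TREE (computable part, M3a)

HONEST FRAMING: per-curve certified theorems and census instruments; no claim on BSD in rank ≥ 2.

The computable decision procedure behind the «nodal image row» and its 2-adic twin (design
`…/kernel-2desc-cl/v2/generics/cq/census-t1/NODAL-ROW-DESIGN.md`, PARI prototypes `nodal/nodalrow_t1.gp`,
`nodal612/nodal612.gp`).  At a support prime `ℓ` of `y² = F(x)` that is TOTALLY SPLIT in `K = ℚ(θ_E)` the three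
roots `e₀, e₁, e₂ ∈ ℤ_ℓ` of `F` give the local descent map `x ↦ (cls(x − e_i))_i ∈ (ℚ_ℓ^×/ℚ_ℓ^{×2})³`; its image
on `E(ℚ_ℓ)` is decided EXACTLY by a one-variable tree on the residue of `x mod ℓ^j`:

* a residue `r mod ℓ^j` is a LEAF when every `w_i = r − ē_i` is non-zero with its square class determined
  (`v_ℓ(w_i) + m ≤ j`, `m = 1` for odd `ℓ`, `m = 3` for `ℓ = 2`); the leaf is ACCEPTED iff the product class is
  a square (`Σ v_i` even and every character sum even) and then contributes its vector;
* at the terminal level (`K = D + 1`, resp. `J = D + 4` at `2`, `D = max v(ē_i − ē_j)`) a residue still matching a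
  root `i` matches exactly one; the other two classes are determined and `w_i` ranges over a coset, so the
  accepted vectors are the candidates for `cls(w_i)` that make the product a square;
* poles: `v(x) ≤ −2` even gives the zero vector (odd `ℓ`; at `2`: `v(x) ≤ −4`), and at `2` the four classes
  `x = u/4` give four more leaves.

This file is PURE COMPUTATION (`Bool`/`ℕ`/`List`-valued functions, no theorems): `valNat`, the bit encoders
`bitsOdd` / `bitsTwo`, the node functions `nodeOdd` / `nodeTwo` (leaf test `leafOdd` / `leafTwo`, matching root
`matchOdd` / `matchTwo`, terminal candidates `termOdd` / `termTwo`), the trees `splitImgOdd` / `splitImgTwo` and the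
subgroup test `xorClosed`.  Soundness (M3b, `…SplitImageSound`: every point's vector is produced by an accepted leaf)
and the wiring into the per-curve checker (M4) are separate modules.  Vectors are bitmasks: odd `ℓ` — bit `2i` =
`v(w_i) mod 2`, bit `2i+1` = `[w_i ℓ^{-v} is a non-square mod ℓ]` (Euler's criterion, the landed `eulerBit`);
`ℓ = 2` — bits `3i, 3i+1, 3i+2` = `v mod 2`, `[u ≡ 3 mod 4]`, `[u ≡ 3, 5 mod 8]` for the unit part `u`.

Sorry-free; no axioms beyond the standard three (none used: definitions only).
[cite: Cassels1991LecturesEllipticCurves, §15] [cite: Cohen1993, §1.4.2, §4.8.2]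
-/

set_option linter.dupNamespace false
set_option autoImplicit false

namespace Summit.BirchSwinnertonDyer.BirchSwinnertonDyer.Rank2Observatory.TwoDescCl.SplitImage

open Summit.BirchSwinnertonDyer.BirchSwinnertonDyer.Rank2Observatory.TwoDescCl (eulerBit)

/-! ## Arithmetic helpers (computable, fuel-bounded) -/

/-- `v_ℓ(n)` for `n ≠ 0` (fuel-bounded; `0 ↦ fuel`). [folklore] -/
def valNatAux (ℓ : ℕ) : ℕ → ℕ → ℕ
  | 0, _ => 0
  | fuel + 1, n => if n = 0 then fuel + 1 else if ℓ ≤ 1 then 0 else if n % ℓ = 0 then valNatAux ℓ fuel (n / ℓ) + 1 else 0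

/-- `v_ℓ(n)` (`n ≠ 0`, `ℓ ≥ 2`; fuel `n` suffices since `ℓ^v ≤ n`). [folklore] -/
def valNat (ℓ n : ℕ) : ℕ := valNatAux ℓ n n

/-- `v_ℓ(z)` on integers. [folklore] -/
def valInt (ℓ : ℕ) (z : ℤ) : ℕ := valNat ℓ z.natAbs

/-- The unit part `z / ℓ^{v_ℓ(z)}` of a non-zero integer. [folklore] -/
def unitPart (ℓ : ℕ) (z : ℤ) : ℤ := z / ((ℓ : ℤ) ^ valInt ℓ z)

/-- `[u is a non-square mod ℓ]` for `ℓ ∤ u`, `ℓ` an odd prime: Euler's criterion on the residue `u mod ℓ` (the landed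
`eulerBit`). [cite: Cohen1993, §1.4.2] -/
def nonsqBit (ℓ : ℕ) (u : ℤ) : Bool := eulerBit ℓ (u % (ℓ : ℤ))

/-! ## Bit encoders -/

/-- Odd `ℓ`: the two bits of a class `(v mod 2, nonsquare?)` at root `i`, positions `2i, 2i+1`. [folklore] -/
def mkOdd (i : ℕ) (vpar : Bool) (ns : Bool) : ℕ :=
  (if vpar then 2 ^ (2 * i) else 0) + (if ns then 2 ^ (2 * i + 1) else 0)

/-- Odd `ℓ`: the class of a non-zero `w ∈ ℤ` in `ℚ_ℓ^×/ℚ_ℓ^{×2}` as two bits `(v mod 2, non-square unit part)`,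
placed at positions `2i, 2i+1`. [cite: Cassels1991LecturesEllipticCurves, §15] -/
def bitsOdd (ℓ : ℕ) (i : ℕ) (w : ℤ) : ℕ :=
  mkOdd i (decide (valInt ℓ w % 2 = 1)) (nonsqBit ℓ (unitPart ℓ w))

/-- `ℓ = 2`: the characters `χ₋₁(u) = [u ≡ 3 mod 4]`, `χ₂(u) = [u ≡ 3, 5 mod 8]` of an odd `u`. [folklore] -/
def chiBits (u : ℤ) : Bool × Bool := (decide (u % 4 = 3), decide (u % 8 = 3 ∨ u % 8 = 5))

/-- `ℓ = 2`: three bits `(v mod 2, χ₋₁, χ₂)` of a class at root `i`, positions `3i, 3i+1, 3i+2`. [folklore] -/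
def mkTwo (i : ℕ) (vpar : Bool) (c : Bool × Bool) : ℕ :=
  (if vpar then 2 ^ (3 * i) else 0) + (if c.1 then 2 ^ (3 * i + 1) else 0) + (if c.2 then 2 ^ (3 * i + 2) else 0)

/-- `ℓ = 2`: the class of a non-zero `w ∈ ℤ` in `ℚ₂^×/ℚ₂^{×2}` (eight classes). [cite: Cassels1991LecturesEllipticCurves, §15] -/
def bitsTwo (i : ℕ) (w : ℤ) : ℕ := mkTwo i (decide (valInt 2 w % 2 = 1)) (chiBits (unitPart 2 w))

/-- Bit `k` of a mask. [folklore] -/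
def testBit' (n k : ℕ) : Bool := (n / 2 ^ k) % 2 == 1

/-- XOR of two masks below `2^width` (computed bitwise). [folklore] -/
def xorMask (width a b : ℕ) : ℕ :=
  ((List.range width).map fun k => if testBit' a k != testBit' b k then 2 ^ k else 0).sum

/-- Odd `ℓ`: a 6-bit vector is a SQUARE PRODUCT iff `Σ v_i` and `Σ ns_i` are even.
[cite: Cassels1991LecturesEllipticCurves, §15] -/
def sqOkOdd (bv : ℕ) : Bool :=
  ((testBit' bv 0 != testBit' bv 2) != testBit' bv 4) == false &&
    ((testBit' bv 1 != testBit' bv 3) != testBit' bv 5) == false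

/-- `ℓ = 2`: a 9-bit vector is a square product iff the three coordinate sums are even.
[cite: Cassels1991LecturesEllipticCurves, §15] -/
def sqOkTwo (bv : ℕ) : Bool :=
  ((testBit' bv 0 != testBit' bv 3) != testBit' bv 6) == false &&
    ((testBit' bv 1 != testBit' bv 4) != testBit' bv 7) == false &&
    ((testBit' bv 2 != testBit' bv 5) != testBit' bv 8) == false

/-! ## The trees -/

/-- `D = max_{i<j} v_ℓ(ē_i − ē_j)` (the node depth). [folklore] -/
def nodeDepth (ℓ : ℕ) (e : Fin 3 → ℤ) : ℕ :=
  max (valInt ℓ (e 0 - e 1)) (max (valInt ℓ (e 0 - e 2)) (valInt ℓ (e 1 - e 2)))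

/-- Odd `ℓ`: root `i` is DETERMINED at the residue `r mod ℓ^j` iff `w_i = r − ē_i ≠ 0` and `v_ℓ(w_i) < j`.
[folklore] -/
def leafOdd (ℓ : ℕ) (e : Fin 3 → ℤ) (j : ℕ) (r : ℤ) (i : Fin 3) : Bool :=
  decide (r - e i ≠ 0) && decide (valInt ℓ (r - e i) < j)

/-- Odd `ℓ`: the full 6-bit vector of a leaf residue. [folklore] -/
def bvOdd (ℓ : ℕ) (e : Fin 3 → ℤ) (r : ℤ) : ℕ :=
  bitsOdd ℓ 0 (r - e 0) + bitsOdd ℓ 1 (r - e 1) + bitsOdd ℓ 2 (r - e 2)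

/-- Odd `ℓ`: the bits of the two roots OTHER than `i`. [folklore] -/
def baseOdd (ℓ : ℕ) (e : Fin 3 → ℤ) (r : ℤ) (i : Fin 3) : ℕ :=
  if i = 0 then bitsOdd ℓ 1 (r - e 1) + bitsOdd ℓ 2 (r - e 2)
  else if i = 1 then bitsOdd ℓ 0 (r - e 0) + bitsOdd ℓ 2 (r - e 2)
  else bitsOdd ℓ 0 (r - e 0) + bitsOdd ℓ 1 (r - e 1)

/-- Odd `ℓ`: the matching root of a non-leaf residue (the first undetermined one; at the terminal level it is unique).
[folklore] -/
def matchOdd (ℓ : ℕ) (e : Fin 3 → ℤ) (j : ℕ) (r : ℤ) : Fin 3 :=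
  if leafOdd ℓ e j r 0 = false then 0 else if leafOdd ℓ e j r 1 = false then 1 else 2

/-- The four classes of `ℚ_ℓ^×/ℚ_ℓ^{×2}`, `ℓ` odd, as `(v mod 2, nonsquare?)`.
[cite: Cassels1991LecturesEllipticCurves, §15] -/
def fourClasses : List (Bool × Bool) := [(false, false), (false, true), (true, false), (true, true)]

/-- Odd `ℓ`, terminal residue matching root `i`: `w_i` ranges over a whole coset `ℓ^K ℤ_ℓ`, so every class for
root `i` that makes the product a square is accepted. [cite: Cassels1991LecturesEllipticCurves, §15] -/
def termOdd (ℓ : ℕ) (e : Fin 3 → ℤ) (r : ℤ) (i : Fin 3) : List ℕ :=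
  fourClasses.filterMap fun c =>
    if sqOkOdd (baseOdd ℓ e r i + mkOdd i.val c.1 c.2) then some (baseOdd ℓ e r i + mkOdd i.val c.1 c.2) else none

/-- Odd `ℓ`, one residue `r mod ℓ^j` (`1 ≤ j ≤ K`): `none` = refine further; `some vs` = the accepted vectors of
this leaf / terminal residue. [cite: Cassels1991LecturesEllipticCurves, §15] -/
def nodeOdd (ℓ K : ℕ) (e : Fin 3 → ℤ) (j : ℕ) (r : ℤ) : Option (List ℕ) :=
  if leafOdd ℓ e j r 0 && leafOdd ℓ e j r 1 && leafOdd ℓ e j r 2 then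
    some (if sqOkOdd (bvOdd ℓ e r) then [bvOdd ℓ e r] else [])
  else if j < K then none
  else some (termOdd ℓ e r (matchOdd ℓ e j r))

/-- Odd `ℓ`: process level `j` on the live residues (fuel-bounded over levels); returns the accepted vectors.
[cite: Cassels1991LecturesEllipticCurves, §15] -/
def levelsOdd (ℓ K : ℕ) (e : Fin 3 → ℤ) : ℕ → ℕ → List ℤ → List ℕ
  | 0, _, _ => []
  | fuel + 1, j, live =>
    let children : List ℤ := live.flatMap fun r0 => (List.range ℓ).map fun (a : ℕ) => r0 + (a : ℤ) * (ℓ : ℤ) ^ (j - 1)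
    let step := children.map fun r => (r, nodeOdd ℓ K e j r)
    let acc : List ℕ := step.flatMap fun p => (p.2.getD [])
    let next : List ℤ := step.filterMap fun p => if p.2.isNone then some p.1 else none
    acc ++ (if next.isEmpty then [] else levelsOdd ℓ K e fuel (j + 1) next)

/-- **The exact split local image at an odd totally split `ℓ`** (as a deduplicated list of 6-bit masks): the zero
vector (poles `v(x) ≤ −2` and the neutral class), and the accepted vectors of the tree of depth `K = D + 1`.
Input: `ē_i mod ℓ^K` as integers. [cite: Cassels1991LecturesEllipticCurves, §15] -/
def splitImgOdd (ℓ : ℕ) (e : Fin 3 → ℤ) : List ℕ :=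
  let K := nodeDepth ℓ e + 1
  (0 :: levelsOdd ℓ K e (K + 1) 1 [0]).dedup

/-- `ℓ = 2`: root `i` is DETERMINED at `r mod 2^j` iff `w_i = r − ē_i ≠ 0` and `v_2(w_i) + 3 ≤ j`. [folklore] -/
def leafTwo (e : Fin 3 → ℤ) (j : ℕ) (r : ℤ) (i : Fin 3) : Bool :=
  decide (r - e i ≠ 0) && decide (valInt 2 (r - e i) + 3 ≤ j)

/-- `ℓ = 2`: the full 9-bit vector of a leaf residue. [folklore] -/
def bvTwo (e : Fin 3 → ℤ) (r : ℤ) : ℕ := bitsTwo 0 (r - e 0) + bitsTwo 1 (r - e 1) + bitsTwo 2 (r - e 2)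

/-- `ℓ = 2`: the bits of the two roots other than `i`. [folklore] -/
def baseTwo (e : Fin 3 → ℤ) (r : ℤ) (i : Fin 3) : ℕ :=
  if i = 0 then bitsTwo 1 (r - e 1) + bitsTwo 2 (r - e 2)
  else if i = 1 then bitsTwo 0 (r - e 0) + bitsTwo 2 (r - e 2)
  else bitsTwo 0 (r - e 0) + bitsTwo 1 (r - e 1)

/-- `ℓ = 2`: the matching root of a non-leaf residue. [folklore] -/
def matchTwo (e : Fin 3 → ℤ) (j : ℕ) (r : ℤ) : Fin 3 :=
  if leafTwo e j r 0 = false then 0 else if leafTwo e j r 1 = false then 1 else 2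

/-- The four unit classes of `ℚ₂^×/ℚ₂^{×2}` as `(χ₋₁, χ₂)` of `1, 3, 5, 7`.
[cite: Cassels1991LecturesEllipticCurves, §15] -/
def unitClasses : List (Bool × Bool) := [chiBits 1, chiBits 3, chiBits 5, chiBits 7]

/-- `ℓ = 2`, terminal residue matching root `i` (`w_i ≡ d := r − ē_i (mod 2^j)`, `v = v_2(d)`): the candidate
classes `(v mod 2, χ₋₁, χ₂)` of `w_i` on its coset — `d = 0` or `v ≥ j`: all eight; `v = j − 1`: `v` fixed, all
units; `v = j − 2`: `v` fixed, unit `≡ c, c + 4 (mod 8)` with `c = (d/2^v) mod 4`.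
[cite: Cassels1991LecturesEllipticCurves, §15] -/
def candTwo (e : Fin 3 → ℤ) (j : ℕ) (r : ℤ) (i : Fin 3) : List (Bool × (Bool × Bool)) :=
  let d := r - e i
  let v := valInt 2 d
  if d = 0 ∨ j ≤ v then (unitClasses.map fun c => (false, c)) ++ (unitClasses.map fun c => (true, c))
  else if v + 1 = j then unitClasses.map fun c => (decide (v % 2 = 1), c)
  else [(decide (v % 2 = 1), chiBits (unitPart 2 d % 4)), (decide (v % 2 = 1), chiBits (unitPart 2 d % 4 + 4))]

/-- `ℓ = 2`, terminal residue: the accepted vectors. [cite: Cassels1991LecturesEllipticCurves, §15] -/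
def termTwo (e : Fin 3 → ℤ) (j : ℕ) (r : ℤ) (i : Fin 3) : List ℕ :=
  (candTwo e j r i).filterMap fun c =>
    if sqOkTwo (baseTwo e r i + mkTwo i.val c.1 c.2) then some (baseTwo e r i + mkTwo i.val c.1 c.2) else none

/-- `ℓ = 2`, one residue `r mod 2^j`: `none` = refine; `some vs` = accepted vectors (leaf or terminal `j = J`).
[cite: Cassels1991LecturesEllipticCurves, §15] -/
def nodeTwo (J : ℕ) (e : Fin 3 → ℤ) (j : ℕ) (r : ℤ) : Option (List ℕ) :=
  if leafTwo e j r 0 && leafTwo e j r 1 && leafTwo e j r 2 then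
    some (if sqOkTwo (bvTwo e r) then [bvTwo e r] else [])
  else if j < J then none
  else some (termTwo e j r (matchTwo e j r))

/-- `ℓ = 2`: the level recursion. [cite: Cassels1991LecturesEllipticCurves, §15] -/
def levelsTwo (J : ℕ) (e : Fin 3 → ℤ) : ℕ → ℕ → List ℤ → List ℕ
  | 0, _, _ => []
  | fuel + 1, j, live =>
    let children : List ℤ := live.flatMap fun r0 => [r0, r0 + (2 : ℤ) ^ (j - 1)]
    let step := children.map fun r => (r, nodeTwo J e j r)
    let acc : List ℕ := step.flatMap fun p => (p.2.getD [])
    let next : List ℤ := step.filterMap fun p => if p.2.isNone then some p.1 else none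
    acc ++ (if next.isEmpty then [] else levelsTwo J e fuel (j + 1) next)

/-- `ℓ = 2`: the four pole leaves `x = u/4`, `u` odd mod 8: `w_i = (u − 4ē_i)/4` has `v = −2` (even) and unit
`≡ u + 4 ē_i (mod 8)`; accepted iff the product is a square. [cite: Cassels1991LecturesEllipticCurves, §15] -/
def polesTwo (e : Fin 3 → ℤ) : List ℕ :=
  ([1, 3, 5, 7] : List ℤ).filterMap fun u =>
    let bv := mkTwo 0 false (chiBits (u + 4 * (e 0 % 2))) + mkTwo 1 false (chiBits (u + 4 * (e 1 % 2))) +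
      mkTwo 2 false (chiBits (u + 4 * (e 2 % 2)))
    if sqOkTwo bv then some bv else none

/-- **The exact split local image at `2` totally split** (deduplicated 9-bit masks): zero vector, pole leaves,
and the tree of depth `J = D + 4`.  Input: `ē_i mod 2^J`. [cite: Cassels1991LecturesEllipticCurves, §15] -/
def splitImgTwo (e : Fin 3 → ℤ) : List ℕ :=
  let J := nodeDepth 2 e + 4
  (0 :: (polesTwo e ++ levelsTwo J e (J + 1) 1 [0])).dedup

/-- Subgroup test: the list is closed under XOR (it always contains `0`).
[cite: Cassels1991LecturesEllipticCurves, §15] -/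
def xorClosed (width : ℕ) (S : List ℕ) : Bool :=
  S.all fun a => S.all fun b => decide (xorMask width a b ∈ S)

end Summit.BirchSwinnertonDyer.BirchSwinnertonDyer.Rank2Observatory.TwoDescCl.SplitImage
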